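import Literature.AnabelianGeometry.AbsoluteAnabelian.LocalUnramifiedQuotientH2
import Literature.NumberTheory.GaloisRepresentations.UnramifiedKummer
import Literature.NumberTheory.GaloisRepresentations.MaxUnramifiedIntegers
import Literature.NumberTheory.GaloisRepresentations.KummerSES
import Literature.NumberTheory.GaloisRepresentations.InfResTwoExact
import HarnessLib

/-!
# The valuation `(F^nr)ˣ → ℤ` as a map of discrete `Gal(F^nr/F)`-modules, its splitting by a
# uniformiser, and the short exact sequence `0 → U^nr → (F^nr)ˣ → ℤ → 0`

For a non-archimedean local field `F` of characteristic `0`, `Γ_F = Gal(F̄/F)`, `I_F = galUnr F`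
(`= absInertia F`, `galUnr_eq_absInertia`) and `Q = Γ_F ⧸ I_F = Gal(F^nr/F)`, the `I_F`-invariants
of the discrete Galois module `K̄ˣ = units F` form the `Q`-module `(K̄ˣ)^{I_F} = (F^nr)ˣ`
(`(units F).quotientInvariants (galUnr F)`; `F^nr = maxUnramified F` is the fixed field of `I_F`,
`mem_absInertia_iff_forall_mem_maxUnramified` + infinite Galois theory).  Since `F^nr/F` is
unramified (`exists_algNorm_eq_zpow_of_mem_maxUnramified`: every non-zero element of `F^nr` has
absolute value in `‖ϖ_F‖^ℤ`), the normalised valuation is `ℤ`-valued on `(F^nr)ˣ`: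

* `unrOrd F x ∈ ℤ` — the order of `x ∈ F^nr`, `‖x‖ = ‖ϖ_F‖ ^ unrOrd F x` (`0` off `F^nr ∖ {0}`);
  multiplicative, `Γ_F`-invariant (`algNorm_smul`), `= 1` on uniformisers of `F`;
* `unrValuationHom F : (F^nr)ˣ ⟶ ℤ` — the valuation as a morphism of discrete `Q`-modules to the
  trivial module `ZCoeff` (the coefficient module of the trunk's `H2UnrEquivQModZ :
  H²(Gal(F^nr/F), ℤ) ⥲ ℚ/ℤ`), SURJECTIVE;
* `unrUniformizerSection F hϖ : ℤ ⟶ (F^nr)ˣ`, `n ↦ ϖ^n` for a uniformiser `ϖ ∈ F` — a `Q`-equivariant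
  SECTION (`ϖ` is `Γ_F`-fixed): `unrUniformizerSection ≫ unrValuationHom = 𝟙`; hence
  `cohomologyMap (unrValuationHom F) n` is SURJECTIVE in every degree (`Hⁿ(Q, (F^nr)ˣ) ↠ Hⁿ(Q, ℤ)`
  is split) — no vanishing theorem is needed for this half;
* `unrUnitsRep F` — the kernel `U^nr = 𝒪^×_{F^nr}` (`‖x‖ = 1`) as a discrete `Q`-module, with
  `isSES_unrUnits : IsSES (unrUnitsIncl F) (unrValuationHom F)` — the short exact sequence
  `0 → U^nr → (F^nr)ˣ → ℤ → 0` of discrete `Q`-modules, so that the trunk's long exact sequence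
  (`ContinuousCohomologyConnecting`) applies: INJECTIVITY of `H²(Q, (F^nr)ˣ) → H²(Q, ℤ)` is exactly
  `H²(Q, U^nr) = 0` (unramified units are cohomologically trivial — the remaining brick).

This is the middle arrow «`H²(Gal(K^unr/K), (K^unr)ˣ) ⥲ H²(Gal(K^unr/K), ℤ)`» of the printed proof of
[AbsAnab] Prop 1.2.1 (vii) (p. 11–12, N3), of [AbsTopIII] Prop 3.2 (i) (p. 71 l.36–57: «units …
cohomologically trivial», «a generator of the monoid `M^unr/(M^unr)^× ≅ ℕ`» = the valuation) and of
[FrdII] Thm 2.4 (ii) (p. 21 ll.16–22).  abc-iut sub-DAG rows: AbsAnab:Prop1.2.1(vii)/L05′,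
AbsTopIII:Prop3.2/P32.i.L03–L04, FrdII:Thm2.4(ii)/L20.  HONEST FRAMING: textbook local class field
theory (Serre, *Local Fields* XII §3, XIII §3); nothing here bears on [IUTchIII] Cor. 3.12.

## References
* J.-P. Serre, *Local Fields*, GTM 67 (1979), XII §3, XIII §3. [SerreLocalFields1979]
* S. Mochizuki, *The absolute anabelian geometry of hyperbolic curves* (2004), Prop 1.2.1 (vii).
  [MochizukiAbsAnab2004]
-/

noncomputable section

open CategoryTheory Function
open Field IsNonarchimedeanLocalField ValuativeRel IntermediateField

universe u

namespace Literature.AnabelianGeometry.AbsoluteAnabelian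

open Literature.NumberTheory.GaloisRepresentations
open Literature.NumberTheory.GaloisRepresentations.IsNonarchimedeanLocalField
open Literature.NumberTheory.GaloisRepresentations.DiscreteGaloisModule
open _root_.TopRep _root_.ContRepresentation _root_.ContinuousCohomology _root_.Topology

variable (F : Type u) [Field F] [ValuativeRel F] [TopologicalSpace F] [IsNonarchimedeanLocalField F]

/-! ### §1 The order `unrOrd` on `F^nr` -/

/-- A fixed uniformiser of `F` (an irreducible element of `𝒪[F]`, by choice); only its absolute
value `‖ϖ_F‖`, common to all uniformisers, matters below. [cite: SerreLocalFields1979, II §3] -/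
def unrUniformizer : 𝒪[F] :=
  Classical.choose (IsDiscreteValuationRing.exists_irreducible 𝒪[F])

/-- The chosen uniformiser is irreducible. [cite: SerreLocalFields1979, II §3] -/
theorem irreducible_unrUniformizer : Irreducible (unrUniformizer F) :=
  Classical.choose_spec (IsDiscreteValuationRing.exists_irreducible 𝒪[F])

/-- **The order of an element of `F^nr`**: the integer `n` with `‖x‖ = ‖ϖ_F‖ ^ n` for
`x ∈ F^nr = maxUnramified F` non-zero (`exists_algNorm_eq_zpow_of_mem_maxUnramified` — `F^nr/F` is
unramified), and `0` otherwise (junk value).  «The valuation `(K^unr)ˣ → ℤ`».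
[cite: SerreLocalFields1979, III §5 Thm. 2] -/
def unrOrd (x : AlgebraicClosure F) : ℤ :=
  open scoped Classical in
  if h : x ∈ maxUnramified F ∧ x ≠ 0 then
    Classical.choose (exists_algNorm_eq_zpow_of_mem_maxUnramified (irreducible_unrUniformizer F) h.1 h.2)
  else 0

/-- `‖x‖ = ‖ϖ_F‖ ^ unrOrd x` for `x ∈ F^nr` non-zero. [cite: SerreLocalFields1979, III §5 Thm. 2] -/
theorem algNorm_eq_zpow_unrOrd {x : AlgebraicClosure F} (hx : x ∈ maxUnramified F) (hx0 : x ≠ 0) :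
    algNorm F x =
      algNorm F (algebraMap 𝒪[F] (AlgebraicClosure F) (unrUniformizer F)) ^ unrOrd F x := by
  classical
  rw [unrOrd, dif_pos ⟨hx, hx0⟩]
  exact Classical.choose_spec
    (exists_algNorm_eq_zpow_of_mem_maxUnramified (irreducible_unrUniformizer F) hx hx0)

/-- `unrOrd x` is characterised by `‖x‖ = ‖ϖ_F‖ ^ n` (`0 < ‖ϖ_F‖ < 1`). [cite: SerreLocalFields1979, III §5 Thm. 2] -/
theorem unrOrd_eq_of_algNorm_eq {x : AlgebraicClosure F} (hx : x ∈ maxUnramified F) (hx0 : x ≠ 0)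
    {n : ℤ} (h : algNorm F x = algNorm F (algebraMap 𝒪[F] (AlgebraicClosure F) (unrUniformizer F)) ^ n) :
    unrOrd F x = n := by
  have hinj := zpow_right_injective₀ (algNorm_uniformizer_pos (irreducible_unrUniformizer F))
    (algNorm_uniformizer_lt_one (irreducible_unrUniformizer F)).ne
  exact hinj ((algNorm_eq_zpow_unrOrd F hx hx0).symm.trans h)

/-- `unrOrd` is additive on products of non-zero elements of `F^nr` (the valuation of `K^unr` is a
homomorphism). [cite: SerreLocalFields1979, III §5 Thm. 2] -/
theorem unrOrd_mul {x y : AlgebraicClosure F} (hx : x ∈ maxUnramified F) (hy : y ∈ maxUnramified F)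
    (hx0 : x ≠ 0) (hy0 : y ≠ 0) : unrOrd F (x * y) = unrOrd F x + unrOrd F y := by
  refine unrOrd_eq_of_algNorm_eq F (mul_mem hx hy) (mul_ne_zero hx0 hy0) ?_
  rw [algNorm_mul, algNorm_eq_zpow_unrOrd F hx hx0, algNorm_eq_zpow_unrOrd F hy hy0,
    ← zpow_add₀ (algNorm_uniformizer_pos (irreducible_unrUniformizer F)).ne']

/-- `unrOrd 1 = 0`. [cite: SerreLocalFields1979, III §5 Thm. 2] -/
theorem unrOrd_one : unrOrd F 1 = 0 :=
  unrOrd_eq_of_algNorm_eq F (one_mem _) one_ne_zero (by rw [algNorm_one, zpow_zero])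

/-- `unrOrd` is `Γ_F`-invariant (`Γ_F` acts by isometries and preserves `F^nr`): the valuation of
`K^unr` is `Gal(K^unr/K)`-invariant. [cite: SerreLocalFields1979, III §5 Thm. 2] -/
theorem unrOrd_smul (σ : absoluteGaloisGroup F) {x : AlgebraicClosure F} (hx : x ∈ maxUnramified F)
    (hx0 : x ≠ 0) : unrOrd F (σ • x) = unrOrd F x :=
  unrOrd_eq_of_algNorm_eq F (smul_mem_maxUnramified σ hx) ((smul_ne_zero_iff_ne σ).2 hx0)
    (by rw [algNorm_smul, algNorm_eq_zpow_unrOrd F hx hx0])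

/-- **A uniformiser of `F` has order `1`** (any two uniformisers are associated in the DVR `𝒪[F]`,
and units have absolute value `1`). [cite: SerreLocalFields1979, II §3] -/
theorem unrOrd_algebraMap_eq_one {ϖ : 𝒪[F]} (hϖ : Irreducible ϖ) :
    unrOrd F (algebraMap 𝒪[F] (AlgebraicClosure F) ϖ) = 1 := by
  have hmem : algebraMap 𝒪[F] (AlgebraicClosure F) ϖ ∈ maxUnramified F := by
    rw [IsScalarTower.algebraMap_apply 𝒪[F] F (AlgebraicClosure F)]
    exact IntermediateField.algebraMap_mem _ _
  have h0 : algebraMap 𝒪[F] (AlgebraicClosure F) ϖ ≠ 0 :=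
    (algNorm_pos_iff (F := F)).1 (algNorm_uniformizer_pos hϖ)
  refine unrOrd_eq_of_algNorm_eq F hmem h0 ?_
  obtain ⟨u, hu⟩ := IsDiscreteValuationRing.associated_of_irreducible 𝒪[F]
    (irreducible_unrUniformizer F) hϖ
  rw [zpow_one, ← hu, map_mul, algNorm_mul, algNorm_algebraMap_unit, mul_one]

/-! ### §2 `(K̄ˣ)^{I_F} ⊆ (F^nr)ˣ` -/

/-- **The fixed field of the inertia group is `F^nr`** (characteristic `0`): an element of `F̄`
fixed by every `σ ∈ galUnr F = I_F` lies in `maxUnramified F` (`I_F = Gal(F̄/F^nr)` by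
`mem_absInertia_iff_forall_mem_maxUnramified`, and `F^nr` is the fixed field of its fixing group by
infinite Galois theory). [cite: SerreLocalFields1979, IV §4 Cor. 2 to Prop. 16] -/
theorem mem_maxUnramified_of_forall_galUnr [CharZero F] {x : AlgebraicClosure F}
    (hx : ∀ σ ∈ galUnr F, σ • x = x) : x ∈ maxUnramified F := by
  haveI : IsGalois F (AlgebraicClosure F) := inferInstance
  rw [← InfiniteGalois.fixedField_fixingSubgroup (maxUnramified F)]
  intro τ
  have hτ : (absoluteGaloisGroup.toAlgEquiv F).symm (τ : AlgebraicClosure F ≃ₐ[F] AlgebraicClosure F) ∈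
      galUnr F := by
    rw [galUnr_eq_absInertia, mem_absInertia_iff_forall_mem_maxUnramified]
    intro y hy
    rw [absoluteGaloisGroup.smul_def, MulEquiv.apply_symm_apply]
    exact (IntermediateField.mem_fixingSubgroup_iff _ _).1 τ.2 y hy
  have := hx _ hτ
  rw [absoluteGaloisGroup.smul_def, MulEquiv.apply_symm_apply] at this
  exact this

/-- An `I_F`-invariant element of `K̄ˣ = units F` has its value in `F^nr` (`(K̄ˣ)^{I_K} = (K^unr)ˣ`,
`K^unr` the fixed field of inertia). [cite: SerreLocalFields1979, IV §4 Cor. 2 to Prop. 16] -/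
theorem unitsVal_mem_maxUnramified [CharZero F] (w : (units F).invariantsOf (galUnr F)) :
    (unitsVal F (w : UnitsCarrier F) : AlgebraicClosure F) ∈ maxUnramified F := by
  refine mem_maxUnramified_of_forall_galUnr F fun σ hσ => ?_
  have h : units F σ (w : UnitsCarrier F) = w := w.2 ⟨σ, hσ⟩
  have h' : (unitsVal F (units F σ (w : UnitsCarrier F)) : AlgebraicClosure F) =
      unitsVal F (w : UnitsCarrier F) := congrArg (fun u => (unitsVal F u : AlgebraicClosure F)) h
  rwa [unitsVal_apply, Units.coe_smul] at h'

/-! ### §3 The valuation `(F^nr)ˣ → ℤ` as a map of `Q`-modules -/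

/-- The valuation on the `I_F`-invariants of `K̄ˣ`, as an additive map to `ℤ` (the trunk's
`ZCoeff = ULift ℤ`). [cite: SerreLocalFields1979, XIII §3] -/
def unrValuation [CharZero F] : (units F).invariantsOf (galUnr F) →+ ZCoeff.{u} where
  toFun w := ⟨unrOrd F (unitsVal F (w : UnitsCarrier F) : AlgebraicClosure F)⟩
  map_zero' := by
    apply ULift.ext
    change unrOrd F (unitsVal F (0 : UnitsCarrier F) : AlgebraicClosure F) = 0
    rw [show unitsVal F (0 : UnitsCarrier F) = 1 from rfl, Units.val_one, unrOrd_one]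
  map_add' w w' := by
    apply ULift.ext
    change unrOrd F (unitsVal F ((w : UnitsCarrier F) + (w' : UnitsCarrier F)) : AlgebraicClosure F) =
      unrOrd F (unitsVal F (w : UnitsCarrier F) : AlgebraicClosure F) +
        unrOrd F (unitsVal F (w' : UnitsCarrier F) : AlgebraicClosure F)
    rw [unitsVal_add, Units.val_mul,
      unrOrd_mul F (unitsVal_mem_maxUnramified F w) (unitsVal_mem_maxUnramified F w')
        (Units.ne_zero _) (Units.ne_zero _)]

/-- Unfolding `unrValuation`: the valuation of `(K^unr)ˣ`. [cite: SerreLocalFields1979, XIII §3] -/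
@[simp] theorem unrValuation_apply_down [CharZero F] (w : (units F).invariantsOf (galUnr F)) :
    (unrValuation F w).down = unrOrd F (unitsVal F (w : UnitsCarrier F) : AlgebraicClosure F) := rfl

/-- **The valuation `(F^nr)ˣ → ℤ` as a morphism of discrete `Gal(F^nr/F)`-modules** (target: the
trivial module `ℤ`; equivariance: `Γ_F` acts by isometries). «`H²(G^unr,(K^unr)ˣ) → H²(G^unr, ℤ)`
via the valuation». [cite: MochizukiAbsAnab2004, Prop 1.2.1 (vii) p.11] -/
def unrValuationHom [CharZero F] :
    ((units F).quotientInvariants (galUnr F)).toTopRep ⟶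
      (ContinuousRep.trivial (absoluteGaloisGroup F ⧸ galUnr F) ℤ ZCoeff.{u}).toTopRep :=
  TopRep.ofHom ⟨⟨(unrValuation F).toIntLinearMap, continuous_of_discreteTopology⟩, by
    intro q
    obtain ⟨σ, rfl⟩ := QuotientGroup.mk_surjective q
    ext w
    change unrOrd F (unitsVal F (units F σ (w : UnitsCarrier F)) : AlgebraicClosure F) =
      unrOrd F (unitsVal F (w : UnitsCarrier F) : AlgebraicClosure F)
    rw [unitsVal_apply, Units.coe_smul,
      unrOrd_smul F σ (unitsVal_mem_maxUnramified F w) (Units.ne_zero _)]⟩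

/-- Unfolding `unrValuationHom`: the valuation of `(K^unr)ˣ`. [cite: SerreLocalFields1979, XIII §3] -/
@[simp] theorem unrValuationHom_hom_apply [CharZero F] (w : (units F).invariantsOf (galUnr F)) :
    (unrValuationHom F).hom w = unrValuation F w := rfl

/-! ### §4 The splitting by a uniformiser and surjectivity on cohomology -/

/-- A non-zero element of `F` as an `I_F`-invariant (indeed `Γ_F`-invariant) element of `K̄ˣ`
(`K ⊆ (K^unr)ˣ`). [cite: SerreLocalFields1979, XIII §3] -/
def baseInvariant (x : F) (hx : x ≠ 0) : (units F).invariantsOf (galUnr F) :=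
  ⟨UnitsCarrier.ofUnits (Units.mk0 (algebraMap F (AlgebraicClosure F) x)
      ((map_ne_zero_iff _ (algebraMap F (AlgebraicClosure F)).injective).2 hx)), fun n => by
    change units F (n : absoluteGaloisGroup F) _ = _
    apply unitsVal_injective F
    rw [unitsVal_apply, unitsVal_ofUnits]
    ext
    rw [Units.coe_smul, Units.val_mk0]
    exact (n : absoluteGaloisGroup F).commutes x⟩

/-- The value of `baseInvariant x` (`K ⊆ K^unr`). [cite: SerreLocalFields1979, XIII §3] -/
@[simp] theorem coe_unitsVal_baseInvariant (x : F) (hx : x ≠ 0) :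
    (unitsVal F (baseInvariant F x hx : UnitsCarrier F) : AlgebraicClosure F) =
      algebraMap F (AlgebraicClosure F) x := rfl

/-- `baseInvariant x` is fixed by all of `Γ_F` (`K = (K̄)^{Γ_K}`). [cite: SerreLocalFields1979, XIII §3] -/
theorem units_apply_baseInvariant (x : F) (hx : x ≠ 0) (σ : absoluteGaloisGroup F) :
    units F σ (baseInvariant F x hx : UnitsCarrier F) = baseInvariant F x hx := by
  apply unitsVal_injective F
  rw [unitsVal_apply]
  ext
  rw [Units.coe_smul, coe_unitsVal_baseInvariant]
  exact σ.commutes x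

/-- **The valuation of a uniformiser of `F` is `1`.** [cite: SerreLocalFields1979, II §3] -/
theorem unrValuation_baseInvariant_uniformizer [CharZero F] {ϖ : 𝒪[F]} (hϖ : Irreducible ϖ) :
    unrValuation F (baseInvariant F (ϖ : F) (Subtype.coe_injective.ne hϖ.ne_zero)) = ⟨1⟩ := by
  apply ULift.ext
  have e : algebraMap F (AlgebraicClosure F) (ϖ : F) = algebraMap 𝒪[F] (AlgebraicClosure F) ϖ :=
    (IsScalarTower.algebraMap_apply 𝒪[F] F (AlgebraicClosure F) ϖ).symm
  rw [unrValuation_apply_down, coe_unitsVal_baseInvariant, e, unrOrd_algebraMap_eq_one F hϖ]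

/-- **The valuation `(F^nr)ˣ → ℤ` is surjective.** [cite: SerreLocalFields1979, XIII §3] -/
theorem unrValuation_surjective [CharZero F] : Surjective (unrValuation F) := by
  intro z
  refine ⟨z.down • baseInvariant F (unrUniformizer F : F)
    (Subtype.coe_injective.ne (irreducible_unrUniformizer F).ne_zero), ?_⟩
  rw [map_zsmul, unrValuation_baseInvariant_uniformizer F (irreducible_unrUniformizer F)]
  apply ULift.ext
  change z.down • (1 : ℤ) = z.down
  rw [smul_eq_mul, mul_one]

/-- **The section `ℤ → (F^nr)ˣ`, `n ↦ ϖ^n`** of the valuation by a uniformiser `ϖ ∈ F`, as a morphism of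
discrete `Gal(F^nr/F)`-modules (equivariant because `ϖ` is `Γ_F`-fixed). [cite: SerreLocalFields1979, XIII §3] -/
def unrUniformizerSection {ϖ : 𝒪[F]} (hϖ : Irreducible ϖ) :
    (ContinuousRep.trivial (absoluteGaloisGroup F ⧸ galUnr F) ℤ ZCoeff.{u}).toTopRep ⟶
      ((units F).quotientInvariants (galUnr F)).toTopRep :=
  TopRep.ofHom ⟨⟨((zmultiplesHom ((units F).invariantsOf (galUnr F))
      (baseInvariant F (ϖ : F) (Subtype.coe_injective.ne hϖ.ne_zero))).comp
        (AddEquiv.ulift (α := ℤ)).toAddMonoidHom).toIntLinearMap, continuous_of_discreteTopology⟩, by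
    intro q
    obtain ⟨σ, rfl⟩ := QuotientGroup.mk_surjective q
    ext z
    change ((z.down • baseInvariant F (ϖ : F) (Subtype.coe_injective.ne hϖ.ne_zero) :
        (units F).invariantsOf (galUnr F)) : UnitsCarrier F) =
      units F σ ((z.down • baseInvariant F (ϖ : F) (Subtype.coe_injective.ne hϖ.ne_zero) :
        (units F).invariantsOf (galUnr F)) : UnitsCarrier F)
    rw [Submodule.coe_smul_of_tower, map_zsmul, units_apply_baseInvariant]⟩

/-- **`unrUniformizerSection ≫ unrValuationHom = 𝟙`** (the valuation of `ϖ^n` is `n`).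
[cite: SerreLocalFields1979, XIII §3] -/
theorem unrUniformizerSection_comp_unrValuationHom [CharZero F] {ϖ : 𝒪[F]} (hϖ : Irreducible ϖ) :
    unrUniformizerSection F hϖ ≫ unrValuationHom F = 𝟙 _ := by
  ext z
  change (unrValuation F (z.down • baseInvariant F (ϖ : F) (Subtype.coe_injective.ne hϖ.ne_zero))).down =
    z.down
  rw [map_zsmul, unrValuation_baseInvariant_uniformizer F hϖ]
  change z.down • (1 : ℤ) = z.down
  rw [smul_eq_mul, mul_one]

/-- **`Hⁿ(Gal(F^nr/F), (F^nr)ˣ) → Hⁿ(Gal(F^nr/F), ℤ)` (induced by the valuation) is surjective in every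
degree**: it is split by the uniformiser section. [cite: MochizukiAbsAnab2004, Prop 1.2.1 (vii) p.11] -/
theorem cohomologyMap_unrValuationHom_surjective [CharZero F] (n : ℕ) :
    Surjective (cohomologyMap (unrValuationHom F) n) := by
  intro y
  refine ⟨cohomologyMap (unrUniformizerSection F (irreducible_unrUniformizer F)) n y, ?_⟩
  have hcomp : ∀ z, cohomologyMap (unrUniformizerSection F (irreducible_unrUniformizer F) ≫
        unrValuationHom F) n z =
      cohomologyMap (unrValuationHom F) n
        (cohomologyMap (unrUniformizerSection F (irreducible_unrUniformizer F)) n z) := fun z =>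
    map_comp_apply_of (ContinuousMonoidHom.id _) (ContinuousMonoidHom.id _) (ContinuousMonoidHom.id _)
      (fun _ => rfl) (resIdHom (unrUniformizerSection F (irreducible_unrUniformizer F)))
      (resIdHom (unrValuationHom F)) (resIdHom (unrUniformizerSection F (irreducible_unrUniformizer F) ≫
        unrValuationHom F)) (fun _ => rfl) n z
  rw [← hcomp, unrUniformizerSection_comp_unrValuationHom]
  have hmap : cohomologyMap (𝟙 ((ContinuousRep.trivial (absoluteGaloisGroup F ⧸ galUnr F) ℤ
      ZCoeff.{u}).toTopRep)) n = 𝟙 _ :=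
    ContinuousCohomology.map_id _ n
  rw [hmap]
  rfl

/-! ### §5 The kernel `U^nr` and the short exact sequence `0 → U^nr → (F^nr)ˣ → ℤ → 0` -/

/-- The units `U^nr = 𝒪^×_{F^nr}` of the maximal unramified extension: the kernel of the valuation on
`(F^nr)ˣ` (elements of absolute value `1`), a submodule of the `I_F`-invariants of `K̄ˣ`.
[cite: SerreLocalFields1979, XII §3] -/
def unrUnits [CharZero F] : Submodule ℤ ((units F).invariantsOf (galUnr F)) :=
  (unrValuation F).toIntLinearMap.ker

/-- Membership in `U^nr = 𝒪^×_{K^unr}`: valuation zero. [cite: SerreLocalFields1979, XII §3] -/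
theorem mem_unrUnits_iff [CharZero F] (w : (units F).invariantsOf (galUnr F)) :
    w ∈ unrUnits F ↔ unrValuation F w = 0 := Iff.rfl

/-- **`U^nr` as a discrete `Gal(F^nr/F)`-module** (a `Q`-stable submodule of `(F^nr)ˣ`: the valuation is
`Q`-invariant). [cite: SerreLocalFields1979, XII §3] -/
def unrUnitsRep [CharZero F] :
    ContinuousRep (absoluteGaloisGroup F ⧸ galUnr F) ℤ (unrUnits F) :=
  ((units F).quotientInvariants (galUnr F)).subrepresentation (unrUnits F) fun q w hw => by
    rw [Submodule.mem_comap, mem_unrUnits_iff]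
    rw [mem_unrUnits_iff] at hw
    have h := TopRep.hom_comm_apply (unrValuationHom F) q w
    rw [ContinuousRep.toTopRep_ρ_apply, ContinuousRep.toTopRep_ρ_apply, unrValuationHom_hom_apply,
      unrValuationHom_hom_apply, ContinuousRep.trivial_apply, hw] at h
    exact h

/-- The inclusion `U^nr ↪ (F^nr)ˣ` as a morphism of discrete `Gal(F^nr/F)`-modules.
[cite: SerreLocalFields1979, XII §3] -/
def unrUnitsIncl [CharZero F] :
    (unrUnitsRep F).toTopRep ⟶ ((units F).quotientInvariants (galUnr F)).toTopRep :=
  TopRep.ofHom ⟨⟨(unrUnits F).subtype, continuous_of_discreteTopology⟩, fun _ => rfl⟩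

/-- Unfolding `unrUnitsIncl`: `U^nr ⊆ (K^unr)ˣ`. [cite: SerreLocalFields1979, XII §3] -/
@[simp] theorem unrUnitsIncl_hom_apply [CharZero F] (w : unrUnits F) :
    (unrUnitsIncl F).hom w = (w : (units F).invariantsOf (galUnr F)) := rfl

/-- **The short exact sequence `0 → U^nr → (F^nr)ˣ →(val) ℤ → 0` of discrete
`Gal(F^nr/F)`-modules.**  With the trunk's long exact sequence: `H²(val)` is injective iff (given
surjectivity of `H²(U^nr) → …`) `H²(Gal(F^nr/F), U^nr) → H²(Gal(F^nr/F), (F^nr)ˣ)` vanishes, in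
particular if `H²(Gal(F^nr/F), U^nr) = 0`. [cite: SerreLocalFields1979, XIII §3] -/
theorem isSES_unrUnits [CharZero F] : IsSES (unrUnitsIncl F) (unrValuationHom F) where
  comp_eq_zero := by
    ext w
    change (unrValuation F (w : (units F).invariantsOf (galUnr F))).down = (0 : ZCoeff.{u}).down
    rw [(mem_unrUnits_iff F _).1 w.2]
  injective := Subtype.val_injective
  exact_mid := fun w hw => ⟨⟨w, hw⟩, rfl⟩
  surjective := unrValuation_surjective F

/-- **`H²(val) : H²(Gal(F^nr/F), (F^nr)ˣ) → H²(Gal(F^nr/F), ℤ)` is injective as soon as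
`H²(Gal(F^nr/F), U^nr) = 0`** (exactness of the trunk's long exact sequence at `H²((F^nr)ˣ)`); with
`cohomologyMap_unrValuationHom_surjective` it is then bijective — «`H²(G^unr,(K^unr)ˣ) ⥲ H²(G^unr, ℤ)`
via the valuation». [cite: MochizukiAbsAnab2004, Prop 1.2.1 (vii) p.11] -/
theorem cohomologyMap_unrValuationHom_two_injective_of_subsingleton [CharZero F]
    (hU : Subsingleton (continuousCohomology 2 (unrUnitsRep F).toTopRep)) :
    Injective (cohomologyMap (unrValuationHom F) 2) := by
  refine (injective_iff_map_eq_zero _).2 fun x hx => ?_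
  obtain ⟨z, rfl⟩ := (isSES_unrUnits F).exists_map_two_eq_of_map_two_eq_zero x hx
  rw [Subsingleton.elim z 0, map_zero]

end Literature.AnabelianGeometry.AbsoluteAnabelian

end
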